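import Summits.HodgeConjecture.HodgeConjecture.Theorems.R90S6GLCosetInvariants   -- ★ W7-f (ii) `relPosition_iff_mem_doubleCoset` (lattice reading); brings ★ `CartanDecompositionGLnUnique` (`existsUnique_antitone_cartanExponents`),
                                                                                   --   ★ `zpowDiagGL` API (`_add`, `_neg`, `_zero`, `mul_zpowDiagGL_const_comm`, `permGL_mul_zpowDiagGL_mul_inv`), ★ W7-f (i) `latt_eq_latt_iff_mem_glInt`
import HarnessLib

/-!
# R90 · S6 «Ch. 14.1–14.5 stable TF» — card L1 (row E1.4.4.2.2, layer 1): THE RELATIVE-POSITION FUNCTION `inv(Λ, Λ′)` OF TWO `GL_N`-LATTICES AND ITS CALCULUS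
# `relPos hϖ g g′ ∈ ℤ^N` antitone — `G`-invariant, `K`-bi-invariant, `inv(Λ,Λ) = 0`, `inv(Λ′,Λ) = −w₀·inv(Λ,Λ′)`, `inv(Λ, ϖ^cΛ′) = inv(Λ,Λ′) + c`, lattice reading (`Theorems/R90S6LatticeInvCalculus.lean`)

Cell `hodgecm-mathlib`, crux H413 (`stmt-HodgeConjecture-24833`), route `HCCMUnconditional`; programme R90-TF, section S6 (base `R90-C14`, dealer R90-C14-plan (g2)), seat
R90-C14-p10 (g0); card **L1** «the inv-calculus of `GL₃(L_w)`-lattices relative to the polarity» (DEAL 2026-09-05T00:12:58Z l.6040; DAG r5 row E1.4.4.2.2 = the 2-dimensional layer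
«lattice geometry of `GL₃(L_w)` relative to the embedded unitary tree», LAYER 1).  Lane `--kind definition --supports stmt-HodgeConjecture-24833` (API module, house-rule (2) exception:
ONE definition — the relative-position FUNCTION, which the row needs as a function to state `inv(PΛ, PΛ′) = −w₀ inv(Λ, Λ′)` — with its laws; no instance, no notation, no named fact, no
`sorry`).  Imports: ★ W7-f (ii) `Theorems.R90S6GLCosetInvariants` + HarnessLib; no `Cruxes` import.  The POLARITY laws (`Θ_σ`-transport, `inv(Λ^♯, Λ′^♯)`, the «distance to the unitary
tree» `inv(Λ, Λ^♯)`) are the sequel file `R90S6LatticeInvPolarity` over ★ p03 W9-a∕b.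

CENSUS (dealer's order): the tree held NO relative-position FUNCTION (`rg` for `cartanExponent|latticeInv|relPos|relativePosition|invariantFactor` over Literature + Summits: only the unrelated
`k[X]`-module `Literature.LinearAlgebra.ElementaryDivisors.elementaryDivisors`); the PROPOSITIONAL estate is ★ and is what this file packages: ★ `CartanUnique.existsUnique_antitone_cartanExponents`
(`∃! a` antitone with `g ∈ GL_N(𝒪) ϖ^a GL_N(𝒪)`, Macdonald V (2.2)), ★ `permGL_mul_zpowDiagGL_mul_inv`, ★ `zpowDiagGL_neg ∕ _add ∕ _zero`, ★ `mul_zpowDiagGL_const_comm`, and ★ W7-f (ii)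
`relPosition_iff_mem_doubleCoset` (shell ⟷ adapted bases of the lattice pair).  Exponents are ANTITONE (`a₁ ≥ ⋯ ≥ a_N`, as in ★ CartanUnique ∕ W7-f ∕ W9-c; the GL Hecke-basis files'
MONOTONE normalisation is `a ∘ rev`).

THE MATHEMATICS (Macdonald 1995 Ch. V §2 (2.2)–(2.6); Garrett, *Buildings* 18.3; Shimura 1971 Lemma 3.11).  `K` a field with Mathlib's `ValuativeRel` whose ring of integers `𝒪` is a
discrete valuation ring, `ϖ` a uniformizing element (`IsUniformizingElement`), `GL_N(𝒪) = glInt N K`, `ϖ^a = zpowDiagGL _ a` (`a ∈ ℤ^N`).  For `g, g′ ∈ GL_N(K)` the RELATIVE POSITION of the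
lattices `Λ = g·𝒪^N`, `Λ′ = g′·𝒪^N` is the unique antitone `a ∈ ℤ^N` with `g⁻¹g′ ∈ GL_N(𝒪) ϖ^a GL_N(𝒪)` — equivalently (★ W7-f (ii)) `Λ` has a basis `(e_i)` with `(ϖ^{a_i}e_i)` a basis of
`Λ′` (the elementary divisors of the pair).  This file makes it a FUNCTION `relPos hϖ g g′` and proves its calculus:
* §1 `relPos` + `relPos_spec` ∕ `antitone_relPos` ∕ `relPos_eq_iff` (characterisation by the Cartan shell);
* §2 **`relPos_mul_left`** (`inv(γΛ, γΛ′) = inv(Λ, Λ′)`), **`relPos_mul_right_of_mem_glInt`** (depends only on the cosets `gK`, `g′K`), **`relPos_self`** (`inv(Λ, Λ) = 0`),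
  **`relPos_swap`** (`inv(Λ′, Λ) = −w₀·inv(Λ, Λ′)`, i.e. `i ↦ −a(rev i)`: invert the shell and re-sort with the long Weyl element `P_rev ∈ GL_N(𝒪)`), **`relPos_mul_zpowDiagGL_const`**
  (`inv(Λ, ϖ^c Λ′) = inv(Λ, Λ′) + (c, …, c)`: the homothety `ϖ^c·1` is central);
* §3 (`K` also `Valued K ℤᵐ⁰`, compatible — the lattice files' currency) **`relPos_eq_iff_latt`** (= ★ W7-f (ii): `relPos = a ⟺ a` antitone and some frame `h` of `Λ` has `h·ϖ^a·𝒪^N = Λ′`)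
  and **`relPos_eq_of_latt_eq`** (`relPos` depends only on the two lattices).
WHY ON PATH: E1.4.4.2.1–.2.3 evaluate bi-`K_E`-invariant Hecke functions at `g⁻¹ δ Θ_σ(g)` as `inv(Λ, P_δΛ)` (★ W9-c) and sum over lattices by relative position to the unitary tree; a
FUNCTION `inv` with the swap ∕ homothety ∕ polarity laws is the floor of that layer (DAG row 130).
HONEST LABEL: packaging of ★ Cartan uniqueness; proves no printed global statement, discharges no citation; count-neutral helper until E1.4.4.2.x consumes it.  HC_CM is proved only modulo
the 7 printed citations (2 remaining named inputs: hLiu418 = stmt-HodgeConjecture-24832, h413 = stmt-HodgeConjecture-24833) until rung 0 closes.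

## References
* [Macdonald1995] I. G. Macdonald, *Symmetric Functions and Hall Polynomials*, 2nd ed. (1995), Ch. V §2 (2.2) («each double coset `KxK` has a unique representative `π^λ`, `λ₁ ≥ ⋯ ≥ λ_n`»),
  (2.4)–(2.6) (relative position of lattices `L`, `Lx`).
* [ShimuraIATAF1971] G. Shimura, *Introduction to the Arithmetic Theory of Automorphic Functions* (1971), §3.2 Lemma 3.11 (elementary divisors of a pair of lattices).
* [BruhatTits1972] F. Bruhat, J. Tits, *Groupes réductifs sur un corps local I*, Publ. Math. IHÉS 41 (1972), (4.4.3) (Cartan decomposition `G = K V_D K`).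
-/
set_option autoImplicit false
-- the mandated namespace repeats the single-problem summit's segment (`HodgeConjecture.HodgeConjecture`)
set_option linter.dupNamespace false

noncomputable section

open scoped Matrix MatrixGroups
open Literature.NumberTheory.Automorphic Literature.NumberTheory.Automorphic.HermitianLattice Literature.NumberTheory.Automorphic.UnitaryLatticeTree

namespace Summit.HodgeConjecture.HodgeConjecture.R90.S6

section Def

variable {K : Type*} [Field K] [ValuativeRel K] {N : ℕ} [IsDiscreteValuationRing (ValuativeRel.valuation K).integer] {ϖ : K}

/-! ## §1 The relative-position function -/

/-- **THE RELATIVE POSITION `inv(g·𝒪^N, g′·𝒪^N) ∈ ℤ^N`** of two framed lattices (`𝒪` a DVR with uniformizing element `ϖ`): the unique ANTITONE exponent vector `a` (`a₁ ≥ ⋯ ≥ a_N`) with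
`g⁻¹g′ ∈ GL_N(𝒪)·ϖ^a·GL_N(𝒪)` (★ `CartanUnique.existsUnique_antitone_cartanExponents`, Macdonald V (2.2)) — equivalently the elementary divisors `ϖ^{a_i}` of the pair: some basis `(e_i)` of
`g·𝒪^N` has `(ϖ^{a_i}e_i)` a basis of `g′·𝒪^N` (★ W7-f (ii), see `relPos_eq_iff_latt`). [cite: Macdonald1995, Ch. V §2 (2.2), (2.6)] [cite: ShimuraIATAF1971, Lemma 3.11] -/
def relPos (hϖ : IsUniformizingElement ϖ) (g g' : GL (Fin N) K) : Fin N → ℤ :=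
  Classical.choose (CartanUnique.existsUnique_antitone_cartanExponents hϖ (g⁻¹ * g')).exists

variable (hϖ : IsUniformizingElement ϖ)
include hϖ

/-- The defining property: `relPos` is antitone and `g⁻¹g′ ∈ GL_N(𝒪)·ϖ^{relPos}·GL_N(𝒪)`. [cite: Macdonald1995, Ch. V §2 (2.2)] -/
theorem relPos_spec (g g' : GL (Fin N) K) :
    Antitone (relPos hϖ g g') ∧ ∃ k₁ ∈ glInt N K, ∃ k₂ ∈ glInt N K, k₁ * (g⁻¹ * g') * k₂ = zpowDiagGL hϖ.ne_zero (relPos hϖ g g') :=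
  Classical.choose_spec (CartanUnique.existsUnique_antitone_cartanExponents hϖ (g⁻¹ * g')).exists

/-- `relPos` is antitone (`a₁ ≥ ⋯ ≥ a_N`). [cite: Macdonald1995, Ch. V §2 (2.2)] -/
theorem antitone_relPos (g g' : GL (Fin N) K) : Antitone (relPos hϖ g g') :=
  (relPos_spec hϖ g g').1

/-- **CHARACTERISATION**: `relPos hϖ g g′ = a` iff `a` is antitone and `g⁻¹g′ ∈ GL_N(𝒪)·ϖ^a·GL_N(𝒪)` (uniqueness of the sorted Cartan exponents, ★ `CartanUnique.existsUnique_antitone_cartanExponents`).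
[cite: Macdonald1995, Ch. V §2 (2.2)] [cite: BruhatTits1972, (4.4.3)] -/
theorem relPos_eq_iff (g g' : GL (Fin N) K) (a : Fin N → ℤ) :
    relPos hϖ g g' = a ↔ Antitone a ∧ ∃ k₁ ∈ glInt N K, ∃ k₂ ∈ glInt N K, k₁ * (g⁻¹ * g') * k₂ = zpowDiagGL hϖ.ne_zero a := by
  constructor
  · rintro rfl
    exact relPos_spec hϖ g g'
  · intro ha
    exact (CartanUnique.existsUnique_antitone_cartanExponents hϖ (g⁻¹ * g')).unique (relPos_spec hϖ g g') ha

/-! ## §2 Invariance, diagonal, swap, homothety -/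

/-- **`inv(γΛ, γΛ′) = inv(Λ, Λ′)`**: `relPos` is invariant under the left action of `GL_N(K)` (`(γg)⁻¹(γg′) = g⁻¹g′`). [cite: Macdonald1995, Ch. V §2 (2.6)] -/
theorem relPos_mul_left (γ g g' : GL (Fin N) K) : relPos hϖ (γ * g) (γ * g') = relPos hϖ g g' := by
  rw [relPos_eq_iff, show (γ * g)⁻¹ * (γ * g') = g⁻¹ * g' by group]
  exact relPos_spec hϖ g g'

/-- **`relPos` depends only on the cosets `gK`, `g′K`** (`K = GL_N(𝒪)`): `relPos hϖ (g k) (g′ k′) = relPos hϖ g g′` for `k, k′ ∈ GL_N(𝒪)`. [cite: Macdonald1995, Ch. V §2 (2.6)] -/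
theorem relPos_mul_right_of_mem_glInt (g g' : GL (Fin N) K) {k k' : GL (Fin N) K} (hk : k ∈ glInt N K) (hk' : k' ∈ glInt N K) :
    relPos hϖ (g * k) (g' * k') = relPos hϖ g g' := by
  rw [relPos_eq_iff]
  obtain ⟨ha, k₁, hk₁, k₂, hk₂, e⟩ := relPos_spec hϖ g g'
  refine ⟨ha, k₁ * k, (glInt N K).mul_mem hk₁ hk, k'⁻¹ * k₂, (glInt N K).mul_mem ((glInt N K).inv_mem hk') hk₂, ?_⟩
  rw [← e]
  group

/-- **`inv(Λ, Λ) = 0`**. [cite: Macdonald1995, Ch. V §2 (2.2)] -/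
theorem relPos_self (g : GL (Fin N) K) : relPos hϖ g g = 0 :=
  (relPos_eq_iff hϖ g g 0).2 ⟨antitone_const, 1, (glInt N K).one_mem, 1, (glInt N K).one_mem,
    by rw [inv_mul_cancel, one_mul, one_mul, zpowDiagGL_zero]⟩

/-- **THE SWAP LAW `inv(Λ′, Λ) = −w₀·inv(Λ, Λ′)`**, i.e. `relPos hϖ g′ g = (i ↦ −relPos hϖ g g′ (rev i))`: invert the shell (`(K ϖ^a K)⁻¹ = K ϖ^{−a} K`, ★ `zpowDiagGL_neg`) and re-sort with the long Weyl
element `P_rev ∈ GL_N(𝒪)` (★ `permGL_mul_zpowDiagGL_mul_inv`, ★ `permGL_mem_glInt`). [cite: Macdonald1995, Ch. V §2 (2.2), (2.6)] -/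
theorem relPos_swap (g g' : GL (Fin N) K) : relPos hϖ g' g = fun i => - relPos hϖ g g' (Fin.rev i) := by
  obtain ⟨ha, k₁, hk₁, k₂, hk₂, e⟩ := relPos_spec hϖ g g'
  refine (relPos_eq_iff hϖ g' g _).2 ⟨fun i j hij => ?_, permGL Fin.revPerm * k₂⁻¹,
    (glInt N K).mul_mem (permGL_mem_glInt _) ((glInt N K).inv_mem hk₂), k₁⁻¹ * (permGL Fin.revPerm)⁻¹,
    (glInt N K).mul_mem ((glInt N K).inv_mem hk₁) ((glInt N K).inv_mem (permGL_mem_glInt _)), ?_⟩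
  · exact neg_le_neg (ha (Fin.rev_le_rev.2 hij))
  · have e' : g'⁻¹ * g = k₂ * (zpowDiagGL hϖ.ne_zero (relPos hϖ g g'))⁻¹ * k₁ := by
      rw [← e]; group
    rw [show (fun i => - relPos hϖ g g' (Fin.rev i)) = (-relPos hϖ g g') ∘ ⇑(Fin.revPerm : Equiv.Perm (Fin N)) from rfl,
      ← CartanUnique.permGL_mul_zpowDiagGL_mul_inv hϖ.ne_zero, zpowDiagGL_neg, e']
    group

/-- **THE HOMOTHETY LAW `inv(Λ, ϖ^c·Λ′) = inv(Λ, Λ′) + (c, …, c)`**: `relPos hϖ g (g′·ϖ^{(c,…,c)}) = relPos hϖ g g′ + (c, …, c)` (the scalar `ϖ^c·1` is central, ★ `mul_zpowDiagGL_const_comm`;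
★ `zpowDiagGL_add`). [cite: Macdonald1995, Ch. V §2 (2.6)] -/
theorem relPos_mul_zpowDiagGL_const (g g' : GL (Fin N) K) (c : ℤ) :
    relPos hϖ g (g' * zpowDiagGL hϖ.ne_zero (fun _ : Fin N => c)) = relPos hϖ g g' + fun _ : Fin N => c := by
  obtain ⟨ha, k₁, hk₁, k₂, hk₂, e⟩ := relPos_spec hϖ g g'
  refine (relPos_eq_iff hϖ g _ _).2 ⟨fun i j hij => ?_, k₁, hk₁, k₂, hk₂, ?_⟩
  · simp only [Pi.add_apply]
    exact add_le_add (ha hij) le_rfl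
  · rw [zpowDiagGL_add, ← e]
    calc k₁ * (g⁻¹ * (g' * zpowDiagGL hϖ.ne_zero fun _ : Fin N => c)) * k₂
        = k₁ * (g⁻¹ * g') * (zpowDiagGL hϖ.ne_zero (fun _ : Fin N => c) * k₂) := by group
      _ = k₁ * (g⁻¹ * g') * (k₂ * zpowDiagGL hϖ.ne_zero fun _ : Fin N => c) := by rw [mul_zpowDiagGL_const_comm hϖ.ne_zero c k₂]
      _ = k₁ * (g⁻¹ * g') * k₂ * zpowDiagGL hϖ.ne_zero (fun _ : Fin N => c) := by group

/-- The homothety law on the other side: `inv(ϖ^c·Λ, Λ′) = inv(Λ, Λ′) − (c, …, c)`. [cite: Macdonald1995, Ch. V §2 (2.6)] -/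
theorem relPos_zpowDiagGL_const_mul (g g' : GL (Fin N) K) (c : ℤ) :
    relPos hϖ (g * zpowDiagGL hϖ.ne_zero (fun _ : Fin N => c)) g' = relPos hϖ g g' - fun _ : Fin N => c := by
  obtain ⟨ha, k₁, hk₁, k₂, hk₂, e⟩ := relPos_spec hϖ g g'
  refine (relPos_eq_iff hϖ _ g' _).2 ⟨fun i j hij => ?_, k₁, hk₁, k₂, hk₂, ?_⟩
  · simp only [Pi.sub_apply]
    exact sub_le_sub_right (ha hij) _
  · have hz : (zpowDiagGL hϖ.ne_zero (fun _ : Fin N => c))⁻¹ = zpowDiagGL hϖ.ne_zero (fun _ : Fin N => -c) := by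
      rw [← zpowDiagGL_neg]; rfl
    rw [show (relPos hϖ g g' - fun _ : Fin N => c) = (fun _ : Fin N => -c) + relPos hϖ g g' from
        funext fun i => by simp only [Pi.sub_apply, Pi.add_apply]; ring,
      zpowDiagGL_add, ← e, mul_inv_rev, hz]
    calc k₁ * (zpowDiagGL hϖ.ne_zero (fun _ : Fin N => -c) * g⁻¹ * g') * k₂
        = k₁ * zpowDiagGL hϖ.ne_zero (fun _ : Fin N => -c) * (g⁻¹ * g') * k₂ := by group
      _ = zpowDiagGL hϖ.ne_zero (fun _ : Fin N => -c) * k₁ * (g⁻¹ * g') * k₂ := by rw [mul_zpowDiagGL_const_comm hϖ.ne_zero (-c) k₁]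
      _ = zpowDiagGL hϖ.ne_zero (fun _ : Fin N => -c) * (k₁ * (g⁻¹ * g') * k₂) := by group

end Def

/-! ## §3 The lattice reading (`Valued` currency of the lattice files) -/

section Lattice

open scoped Valued WithZero

variable {K : Type*} [Field K] [Valued K ℤᵐ⁰] [ValuativeRel K] [(Valued.v : Valuation K ℤᵐ⁰).Compatible] {N : ℕ}
  [IsDiscreteValuationRing (ValuativeRel.valuation K).integer] {ϖ : K} (hϖ : IsUniformizingElement ϖ)
include hϖ

/-- **`relPos` READ ON THE LATTICES** (★ W7-f (ii) `relPosition_iff_mem_doubleCoset`): `relPos hϖ g g′ = a` iff `a` is antitone and some frame `h` of `g·𝒪^N` (`latt h = latt g`) has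
`h·ϖ^a·𝒪^N = g′·𝒪^N` — the elementary divisors of the pair of lattices. [cite: Macdonald1995, Ch. V §2 (2.6)] [cite: ShimuraIATAF1971, Lemma 3.11] -/
theorem relPos_eq_iff_latt (g g' : GL (Fin N) K) (a : Fin N → ℤ) :
    relPos hϖ g g' = a ↔ Antitone a ∧ ∃ h : GL (Fin N) K, latt (h : Matrix (Fin N) (Fin N) K) = latt (g : Matrix (Fin N) (Fin N) K) ∧
      latt ((h * zpowDiagGL hϖ.ne_zero a : GL (Fin N) K) : Matrix (Fin N) (Fin N) K) = latt (g' : Matrix (Fin N) (Fin N) K) := by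
  rw [relPos_eq_iff, relPosition_iff_mem_doubleCoset]

/-- **`relPos` depends only on the two lattices**: `latt g₁ = latt g₂`, `latt g₁′ = latt g₂′ ⟹ relPos hϖ g₁ g₁′ = relPos hϖ g₂ g₂′` (★ W7-f (i) `latt_eq_latt_iff_mem_glInt` + `relPos_mul_right_of_mem_glInt`).
[cite: Macdonald1995, Ch. V §2 (2.6)] -/
theorem relPos_eq_of_latt_eq {g₁ g₂ g₁' g₂' : GL (Fin N) K}
    (hg : latt (g₁ : Matrix (Fin N) (Fin N) K) = latt (g₂ : Matrix (Fin N) (Fin N) K))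
    (hg' : latt (g₁' : Matrix (Fin N) (Fin N) K) = latt (g₂' : Matrix (Fin N) (Fin N) K)) :
    relPos hϖ g₁ g₁' = relPos hϖ g₂ g₂' := by
  rw [latt_eq_latt_iff_mem_glInt] at hg hg'
  rw [show g₂ = g₁ * (g₁⁻¹ * g₂) by group, show g₂' = g₁' * (g₁'⁻¹ * g₂') by group, relPos_mul_right_of_mem_glInt hϖ g₁ g₁' hg hg']

end Lattice

end Summit.HodgeConjecture.HodgeConjecture.R90.S6

end
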